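/-
Copyright (c) 2026 the pub-hodgecm-mathlib formalisation cell (harness21).  Prover seat hodgecm-mathlib-K2E3-p14 (g4), HCML Track B «K2-LIT» (build stream 29),
h413 = `stmt-HodgeConjecture-24833`, line `K2_E3_EllipticInputs`, unit U12 «Characters», §L line (lead K2E3-p12 (g4)), deal (LBU-01) «(L-B_U)′ AT `N ≤ 1` BY POINT
SUPPORT», FILE (F1): THE `δ₀`-PART OF (L-B_U)′ ON `𝔲_N(H_w)` IN EVERY RANK, WITH THE SMOOTHNESS OF `𝓕` AS A HYPOTHESIS.  2026-09-04.
-/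
import Summits.HodgeConjecture.HodgeConjecture.Theorems.K2E3U2NilpotentFourierPointSupport     -- ★ p856833 (K2E5-p12 g2): the `N = 2` template; brings ★ `lieOfForm`, `lieFourier`, `IsLocSmooth` kit, ★ p856457 `apply_eq_apply_indicator_mul_of_notMem_tsupport`, `isOpen_isCompact_matrixIntegerBox`
import HarnessLib

/-!
# K2 ∕ E3, §L deal (LBU-01), FILE (F1) — THE POINT-SUPPORTED PART OF (L-B_U)′ ON `𝔲_N(H_w)` FOR EVERY `N`: IF THE NILPOTENT CONE OF `𝔲(σ_w, H_w)` IS `{0}`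
# AND `𝓕` PRESERVES `C_c^∞`, THEN `J(𝒩) = ℂ·δ₀` AND THE (L-B_U)′ SOCKET STATEMENT HOLDS WITH `Fn ≡ T(1_{K₀})`

Cell `pub/hodgecm-mathlib` (D-0151), Track B «K2-LIT», crux H413 = `stmt-HodgeConjecture-24833` (lane `--supports … --as helper`, count-neutral); seat K2E3-p14 (g4);
§L line lead K2E3-p12 (g4), deal (LBU-01) 2026-09-04T04:40:11Z on `K2/STATUS.md`.  THEOREMS ONLY (no definition ∕ instance ∕ notation ∕ named fact ∕ `sorry`);
never imports `Cruxes/…/Lines`.  The rank-`N` version of ★ p856833 §2 `K2E3U2NilpotentFourierPointSupport.lieNilpotentFourierRegular_of_pointSupport` (`Fin 2 ↦ Fin N`)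
with the one `N`-dependent analytic input — «`𝓕` maps `C_c^∞(𝔲)` to itself» (★ p856833 §1 at `N = 2`, via the trace chart) — turned into the hypothesis `hF`,
and the support clause (iv) of `T ∈ J(𝒩)` reduced to «`0 ∉ supp f ⇒ T f = 0`» by the hypothesis `hcone` (the nilpotent cone is `{0}`): consumed by (F2)
`K2E3U01NilpotentFourierRegular` (the (L-B_U)′ socket :373∕:791 of U12 ED. 11 VERBATIM at `N := 0` and `N := 1`, where `hcone` and `hF` are dischargeable).

SETTING.  `L` CM, `v` finite, `w ∣ v` with `c • w = w`, `σ_w = galAdicCompletionMap c hw`, `H ∈ M_N(L)` hermitian with `det H ≠ 0`, `H_w = placeForm H w`,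
`𝔲 = lieOfForm σ_w H_w ≤ M_N(L_w)`, `μ𝔤` an additive Haar measure on `↥𝔲`, `ψ` a character of `L_w`, `𝓕f(Y) = ∫ ψ(tr(Y·X)) f(X) dμ𝔤` (★ `lieFourier`).
* §1 `lieFourier_apply_zero_fin` — `𝓕f(0) = ∫ f` (any `N`); `isOpen_isCompact_lieIntegerBox` — `K₀ := {X ∈ 𝔲 | X_{ij} ∈ 𝒪}` is a compact open neighbourhood of `0`
  in `↥𝔲` (★ `isOpen_isCompact_matrixIntegerBox` pulled back along the CLOSED embedding `↥𝔲 ↪ M_N(L_w)`, ★ `isClosed_lieOfForm`).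
* §2 **`nilpotentFourierRegular_of_cone_eq_zero`** — binders `(L) (N) (v) (w) (hw) (H) (ψ) [..] (μ𝔤) [..] (hcone) (hF) (T) (hT : ‹the 4 clauses of :791›)`,
  conclusion = the (L-B_U)′ conclusion VERBATIM (`∃ Fn, LocallyIntegrable Fn μ𝔤 ∧ (T(𝓕f) = ∫ f·Fn) ∧ (Fn loc. const at regular X) ∧ (√√|disc χ_X|·‖Fn X‖ bounded on compacta)`),
  with `Fn ≡ c := T(1_{K₀})` (★ `apply_eq_apply_indicator_mul_of_notMem_tsupport`; the `η^{1∕4}`-weight is continuous: ★ `continuous_discr_charpoly`, ★ `continuous_normAbs`).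
  The binders `hH`∕`hdet`∕`hψ`∕`hψι` of :791 are NOT taken here (unused: they only feed `hF`, which (F2) discharges at `N ≤ 1`).
[HarishChandra1999AdmissibleDistributions, Thm. 3.9, Thm. 4.4 p. 11, §21 p. 87] [WeilBNT1967, Ch. II §2].
HONEST LABEL: HC_CM is proved only modulo the 7 printed citations (2 remaining named inputs: hLiu418 = `stmt-HodgeConjecture-24832`, h413 = `stmt-HodgeConjecture-24833`)
until rung 0 closes; count-neutral ((L-B_U)′ :791 for `N ≥ 2` — non-zero nilpotent orbits — is NOT proved here; this is its `{0}`-orbit part in every rank).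

## References
* [HarishChandra1999AdmissibleDistributions] Harish-Chandra (DeBacker–Sally), *Admissible Invariant Distributions on Reductive p-adic Groups* (1999), Thm. 3.9, Thm. 4.4, §21.
* [WeilBNT1967] A. Weil, *Basic Number Theory* (1967), Ch. II §2 (the integers `𝒪` are compact open), Ch. VII §2.
-/

set_option autoImplicit false
set_option linter.dupNamespace false   -- `Summit.HodgeConjecture.HodgeConjecture.…` (D-0017 nested layout; lakefile exemption for Summits)

noncomputable section

open MeasureTheory Filter Topology NumberField IsDedekindDomain
open scoped Matrix MatrixGroups NNReal
open Literature.NumberTheory.Rogawski1990 Literature.NumberTheory.Automorphic Literature.NumberTheory.Automorphic.UnitaryGroup Literature.NumberTheory.Automorphic.LocalFieldHaar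
open Literature.NumberTheory.GaloisRepresentations Literature.NumberTheory.GaloisRepresentations.IsNonarchimedeanLocalField
open Summit.HodgeConjecture.HodgeConjecture.Cruxes.H413.K2E3LieUnitary
open Summit.HodgeConjecture.HodgeConjecture.Cruxes.H413.K2E3GLnNilpotentFourierPointSupport (apply_eq_apply_indicator_mul_of_notMem_tsupport isOpen_isCompact_matrixIntegerBox)

namespace Summit.HodgeConjecture.HodgeConjecture.Cruxes.H413.K2E3LieUnitaryNilpotentFourierRegularOfPointSupport

section CM

variable (L : Type) [Field L] [NumberField L] [IsCMField L] (N : ℕ) (v : HeightOneSpectrum (𝓞 ↥(maximalRealSubfield L)))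
  (w : UnitaryGroup.PlacesOver L v) (hw : IsCMField.complexConj L • w.1 = w.1)

/-! ## §1 `𝓕f(0) = ∫ f`, and the integer box of `𝔲` -/

omit [IsCMField L] in
/-- `𝓕f(0) = ∫ f dμ𝔤` (`ψ(0) = 1`), every rank. [cite: HarishChandra1999AdmissibleDistributions, §4 p. 11] -/
theorem lieFourier_apply_zero_fin {σ : w.1.adicCompletion L →+* w.1.adicCompletion L} {J : Matrix (Fin N) (Fin N) (w.1.adicCompletion L)} (ψ : AddChar (w.1.adicCompletion L) Circle)
    [MeasurableSpace ↥(lieOfForm σ J)] (μ𝔤 : Measure ↥(lieOfForm σ J)) (f : ↥(lieOfForm σ J) → ℂ) :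
    lieFourier σ J (fun x : w.1.adicCompletion L => ((ψ x : Circle) : ℂ)) μ𝔤 f 0 = ∫ X, f X ∂μ𝔤 := by
  rw [lieFourier_apply]
  simp only [ZeroMemClass.coe_zero, zero_mul, Matrix.trace_zero, AddChar.map_zero_eq_one, Circle.coe_one, one_mul]

include hw in
/-- **The integer box `K₀ = {X ∈ 𝔲 | X_{ij} ∈ 𝒪}` of `𝔲(σ_w, H_w)` is a compact open neighbourhood of `0`** (★ `isOpen_isCompact_matrixIntegerBox` in `M_N(L_w)`, pulled back along
the closed embedding `↥𝔲 ↪ M_N(L_w)` — ★ `isClosed_lieOfForm`, `σ_w` continuous). [cite: WeilBNT1967, Ch. II §2] -/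
theorem isOpen_isCompact_lieIntegerBox (H : Matrix (Fin N) (Fin N) L) :
    IsOpen {X : ↥(lieOfForm (galAdicCompletionMap (L := L) (IsCMField.complexConj L) hw) (UnitaryGroup.placeForm H w.1)) |
        ∀ i j, X.1 i j ∈ primePowBall (w.1.adicCompletion L) 0} ∧
      IsCompact {X : ↥(lieOfForm (galAdicCompletionMap (L := L) (IsCMField.complexConj L) hw) (UnitaryGroup.placeForm H w.1)) |
        ∀ i j, X.1 i j ∈ primePowBall (w.1.adicCompletion L) 0} ∧
      (0 : ↥(lieOfForm (galAdicCompletionMap (L := L) (IsCMField.complexConj L) hw) (UnitaryGroup.placeForm H w.1))) ∈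
        {X : ↥(lieOfForm (galAdicCompletionMap (L := L) (IsCMField.complexConj L) hw) (UnitaryGroup.placeForm H w.1)) | ∀ i j, X.1 i j ∈ primePowBall (w.1.adicCompletion L) 0} := by
  haveI : T2Space (w.1.adicCompletion L) := (isLocalField (w.1.adicCompletion L)).toT2Space
  obtain ⟨hBo, hBc, hB0⟩ := isOpen_isCompact_matrixIntegerBox (F := w.1.adicCompletion L) (N := N)
  have hce : Topology.IsClosedEmbedding (Subtype.val : ↥(lieOfForm (galAdicCompletionMap (L := L) (IsCMField.complexConj L) hw) (UnitaryGroup.placeForm H w.1)) →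
      Matrix (Fin N) (Fin N) (w.1.adicCompletion L)) :=
    Topology.IsClosedEmbedding.subtypeVal (isClosed_lieOfForm (σ := galAdicCompletionMap (L := L) (IsCMField.complexConj L) hw)
      (J := UnitaryGroup.placeForm H w.1) (continuous_galAdicCompletionMap L (IsCMField.complexConj L) hw))
  have hset : {X : ↥(lieOfForm (galAdicCompletionMap (L := L) (IsCMField.complexConj L) hw) (UnitaryGroup.placeForm H w.1)) |
      ∀ i j, X.1 i j ∈ primePowBall (w.1.adicCompletion L) 0} =
      Subtype.val ⁻¹' {X : Matrix (Fin N) (Fin N) (w.1.adicCompletion L) | ∀ i j, X i j ∈ primePowBall (w.1.adicCompletion L) 0} := rfl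
  refine ⟨?_, ?_, ?_⟩
  · rw [hset]; exact hBo.preimage continuous_subtype_val
  · rw [hset]; exact hce.isCompact_preimage hBc
  · show ∀ i j, ((0 : ↥(lieOfForm (galAdicCompletionMap (L := L) (IsCMField.complexConj L) hw) (UnitaryGroup.placeForm H w.1))) :
        Matrix (Fin N) (Fin N) (w.1.adicCompletion L)) i j ∈ primePowBall (w.1.adicCompletion L) 0
    intro i j
    rw [ZeroMemClass.coe_zero, Matrix.zero_apply]
    exact zero_mem_primePowBall 0

/-! ## §2 The `δ₀`-part of (L-B_U)′ on `𝔲_N(H_w)`, every rank -/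

set_option maxHeartbeats 1600000 in
include hw in
/-- **THE `δ₀`-PART OF (L-B_U)′ «Thm. 4.4 ∕ §21 for `J(𝒩)` on `𝔲_N(H_w)`» IN EVERY RANK, WITH THE SMOOTHNESS OF `𝓕` AS A HYPOTHESIS.**  If the nilpotent cone of `𝔲(σ_w, H_w)` is
`{0}` (`hcone`) and `𝓕` maps `C_c^∞(𝔲)` to itself (`hF`), then every `T` satisfying the four clauses of the (L-B_U)′ socket (additive, homogeneous, `Ad`-invariant,
vanishing off the nilpotent cone) is point-supported at `0`, and the CONSTANT `Fn ≡ T(1_{K₀})` satisfies the socket's conclusion: locally integrable, `T(𝓕f) = ∫ f·Fn`,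
locally constant, `√√|disc χ_X|·‖Fn‖` bounded on compacta.  Rank-`N` form of ★ p856833 §2. [cite: HarishChandra1999AdmissibleDistributions, Thm. 4.4 p. 11, Thm. 3.9 p. 10, §21 p. 87] -/
theorem nilpotentFourierRegular_of_cone_eq_zero (H : Matrix (Fin N) (Fin N) L) (ψ : AddChar (w.1.adicCompletion L) Circle)
    [MeasurableSpace ↥(lieOfForm (galAdicCompletionMap (L := L) (IsCMField.complexConj L) hw) (UnitaryGroup.placeForm H w.1))]
    [BorelSpace ↥(lieOfForm (galAdicCompletionMap (L := L) (IsCMField.complexConj L) hw) (UnitaryGroup.placeForm H w.1))]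
    (μ𝔤 : Measure ↥(lieOfForm (galAdicCompletionMap (L := L) (IsCMField.complexConj L) hw) (UnitaryGroup.placeForm H w.1))) [μ𝔤.IsAddHaarMeasure]
    (hcone : ∀ X : ↥(lieOfForm (galAdicCompletionMap (L := L) (IsCMField.complexConj L) hw) (UnitaryGroup.placeForm H w.1)), IsNilpotent X.1 → X.1 = 0)
    (hF : ∀ f : ↥(lieOfForm (galAdicCompletionMap (L := L) (IsCMField.complexConj L) hw) (UnitaryGroup.placeForm H w.1)) → ℂ, IsLocSmooth f →
      IsLocSmooth (lieFourier (galAdicCompletionMap (L := L) (IsCMField.complexConj L) hw) (UnitaryGroup.placeForm H w.1) (fun x : w.1.adicCompletion L => ((ψ x : Circle) : ℂ)) μ𝔤 f))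
    (T : (↥(lieOfForm (galAdicCompletionMap (L := L) (IsCMField.complexConj L) hw) (UnitaryGroup.placeForm H w.1)) → ℂ) → ℂ)
    (hT : (∀ f₁ f₂ : ↥(lieOfForm (galAdicCompletionMap (L := L) (IsCMField.complexConj L) hw) (UnitaryGroup.placeForm H w.1)) → ℂ, IsLocSmooth f₁ → IsLocSmooth f₂ → T (f₁ + f₂) = T f₁ + T f₂) ∧
         (∀ (a : ℂ) (f : ↥(lieOfForm (galAdicCompletionMap (L := L) (IsCMField.complexConj L) hw) (UnitaryGroup.placeForm H w.1)) → ℂ), IsLocSmooth f → T (a • f) = a * T f) ∧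
         (∀ (x : ↥(unitaryGroupOfForm (galAdicCompletionMap (L := L) (IsCMField.complexConj L) hw) (UnitaryGroup.placeForm H w.1))) (f : ↥(lieOfForm (galAdicCompletionMap (L := L) (IsCMField.complexConj L) hw) (UnitaryGroup.placeForm H w.1)) → ℂ), IsLocSmooth f →
            T (fun X => f ⟨((x : GL (Fin N) (w.1.adicCompletion L)) : Matrix (Fin N) (Fin N) (w.1.adicCompletion L)) * X.1 * (((x : GL (Fin N) (w.1.adicCompletion L))⁻¹ : GL (Fin N) (w.1.adicCompletion L)) : Matrix (Fin N) (Fin N) (w.1.adicCompletion L)),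
              conj_mem_lieOfForm x.2 X.2⟩) = T f) ∧
         (∀ f : ↥(lieOfForm (galAdicCompletionMap (L := L) (IsCMField.complexConj L) hw) (UnitaryGroup.placeForm H w.1)) → ℂ, IsLocSmooth f → (∀ X ∈ tsupport f, ¬ IsNilpotent X.1) → T f = 0)) :
    ∃ Fn : ↥(lieOfForm (galAdicCompletionMap (L := L) (IsCMField.complexConj L) hw) (UnitaryGroup.placeForm H w.1)) → ℂ, LocallyIntegrable Fn μ𝔤 ∧
      (∀ f : ↥(lieOfForm (galAdicCompletionMap (L := L) (IsCMField.complexConj L) hw) (UnitaryGroup.placeForm H w.1)) → ℂ, IsLocSmooth f →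
        T (lieFourier (galAdicCompletionMap (L := L) (IsCMField.complexConj L) hw) (UnitaryGroup.placeForm H w.1) (fun x : w.1.adicCompletion L => ((ψ x : Circle) : ℂ)) μ𝔤 f) = ∫ X, f X * Fn X ∂μ𝔤) ∧
      (∀ X : ↥(lieOfForm (galAdicCompletionMap (L := L) (IsCMField.complexConj L) hw) (UnitaryGroup.placeForm H w.1)), IsUnit X.1.charpoly.discr → ∀ᶠ Y in 𝓝 X, Fn Y = Fn X) ∧
      (∀ C : Set ↥(lieOfForm (galAdicCompletionMap (L := L) (IsCMField.complexConj L) hw) (UnitaryGroup.placeForm H w.1)), IsCompact C → ∃ B : ℝ, ∀ X ∈ C,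
          ((NNReal.sqrt (NNReal.sqrt (normAbs (w.1.adicCompletion L) X.1.charpoly.discr)) : ℝ≥0) : ℝ) * ‖Fn X‖ ≤ B) := by
  classical
  haveI : T2Space (w.1.adicCompletion L) := (isLocalField (w.1.adicCompletion L)).toT2Space
  haveI : LocallyCompactSpace (w.1.adicCompletion L) := (isLocalField (w.1.adicCompletion L)).toLocallyCompactSpace
  haveI : LocallyCompactSpace (Matrix (Fin N) (Fin N) (w.1.adicCompletion L)) := Pi.locallyCompactSpace_of_finite
  haveI : LocallyCompactSpace ↥(lieOfForm (galAdicCompletionMap (L := L) (IsCMField.complexConj L) hw) (UnitaryGroup.placeForm H w.1)) :=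
    (Topology.IsClosedEmbedding.subtypeVal (isClosed_lieOfForm (σ := galAdicCompletionMap (L := L) (IsCMField.complexConj L) hw)
      (J := UnitaryGroup.placeForm H w.1) (continuous_galAdicCompletionMap L (IsCMField.complexConj L) hw))).locallyCompactSpace
  obtain ⟨hadd, hsmul, -, hN⟩ := hT
  -- point support at `0`
  have h0 : ∀ f : ↥(lieOfForm (galAdicCompletionMap (L := L) (IsCMField.complexConj L) hw) (UnitaryGroup.placeForm H w.1)) → ℂ, IsLocSmooth f →
      (0 : ↥(lieOfForm (galAdicCompletionMap (L := L) (IsCMField.complexConj L) hw) (UnitaryGroup.placeForm H w.1))) ∉ tsupport f → T f = 0 := by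
    intro f hf h0f
    refine hN f hf fun X hX hnil => h0f ?_
    have hX0 : X = 0 := Subtype.ext (by rw [hcone X hnil, ZeroMemClass.coe_zero])
    rwa [hX0] at hX
  -- the compact open box
  obtain ⟨hKo, hKc, hK0⟩ := isOpen_isCompact_lieIntegerBox L N v w hw H
  set c : ℂ := T ({X : ↥(lieOfForm (galAdicCompletionMap (L := L) (IsCMField.complexConj L) hw) (UnitaryGroup.placeForm H w.1)) |
      ∀ i j, X.1 i j ∈ primePowBall (w.1.adicCompletion L) 0}.indicator fun _ => (1 : ℂ)) with hc
  refine ⟨fun _ => c, locallyIntegrable_const c, fun f hf => ?_, fun X _ => Eventually.of_forall fun Y => rfl, fun C hC => ?_⟩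
  · rw [apply_eq_apply_indicator_mul_of_notMem_tsupport hKo hKc hK0 T hadd hsmul h0 (hF f hf), lieFourier_apply_zero_fin, integral_mul_const, mul_comm]
  · have hcont : Continuous fun X : ↥(lieOfForm (galAdicCompletionMap (L := L) (IsCMField.complexConj L) hw) (UnitaryGroup.placeForm H w.1)) =>
        ((NNReal.sqrt (NNReal.sqrt (normAbs (w.1.adicCompletion L) X.1.charpoly.discr)) : ℝ≥0) : ℝ) * ‖c‖ :=
      (NNReal.continuous_coe.comp (NNReal.continuous_sqrt.comp (NNReal.continuous_sqrt.comp (continuous_normAbs.comp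
        (K2E3NormalizedCharBddNearSemisimpleRegular.continuous_discr_charpoly.comp continuous_subtype_val))))).mul continuous_const
    obtain ⟨B, hB⟩ := hC.bddAbove_image hcont.continuousOn
    exact ⟨B, fun X hX => hB (Set.mem_image_of_mem _ hX)⟩

end CM

end Summit.HodgeConjecture.HodgeConjecture.Cruxes.H413.K2E3LieUnitaryNilpotentFourierRegularOfPointSupport

end
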